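import Literature.Analysis.FluidPDE.FiniteFourierModeEulerPolygonB

/-!
# Planar convex geometry of a face of `S^{conv}` seen from a vertex, III: the sides are edges

Support file for `FiniteFourierModeEuler` (N. Kishimoto, T. Yoneda, J. Math. Fluid Mech. 24
(2022) 74 = arXiv:2110.08039), continuing `FiniteFourierModeEulerPolygonB`: every side
`[q_j, q_{j+1}]` (`0 ≤ j ≤ m`, `q₀ = q_{m+1} = p₀`) of the boundary polygon of a face is an EDGE of
`S^{conv}`: all points `s` of the face satisfy `[q_j, q_{j+1}, s] ≥ 0`, with equality exactly for
the points of the segment (`FaceCfg.edge`). Together with (ORI) of part II this is the input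
"`n_j` is a vertex of `S^{conv}` adjacent to `n_{j-1}`" of the proofs of Prop. 4.4 (iv) / 4.7.

## References

* [KishimotoYoneda2022] N. Kishimoto, T. Yoneda, J. Math. Fluid Mech. 24 (2022) 74 =
  arXiv:2110.08039, §4 Lemma 4.5, Props. 4.4, 4.7 (edges of a face of `S^{conv}`).
* [folklore] the boundary of a planar convex polygon.
-/

noncomputable section

open Matrix Set Finset

namespace Literature.Analysis.FluidPDE

namespace KY

open scoped Classical

namespace FaceCfg

variable {S : Finset (Fin 3 → ℝ)} {φ p₀ : Fin 3 → ℝ} {M : ℝ} (h : FaceCfg S φ p₀ M)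
include h

omit h in
/-- Cyclic symmetry `[a, b, x] = x · (a × b)`. [folklore] -/
theorem triple_eq_dot_cross (a b x : Fin 3 → ℝ) : a ⬝ᵥ (b ⨯₃ x) = x ⬝ᵥ (a ⨯₃ b) := by
  simp [cross_apply, dotProduct, Fin.sum_univ_three]; ring

omit h in
/-- A linear functional non-negative on `{p₀} ∪ verts` is non-negative on the face. [folklore] -/
theorem dot_nonneg_on_face {n : Fin 3 → ℝ} (hp : 0 ≤ p₀ ⬝ᵥ n) (hv : ∀ v ∈ verts S φ p₀ M, 0 ≤ v ⬝ᵥ n)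
    {s : Fin 3 → ℝ} (hs : s ∈ face S φ M) : 0 ≤ s ⬝ᵥ n := by
  have hall : ∀ y ∈ insert p₀ ((verts S φ p₀ M : Finset (Fin 3 → ℝ)) : Set (Fin 3 → ℝ)), (-n) ⬝ᵥ y ≤ 0 := by
    intro y hy
    rw [neg_dotProduct, neg_nonpos, dotProduct_comm]
    rcases hy with rfl | hy
    · exact hp
    · exact hv y (Finset.mem_coe.1 hy)
  have := dot_le_of_mem_convexHull hall (face_subset_convexHull (Finset.mem_coe.2 hs))
  rwa [neg_dotProduct, neg_nonpos, dotProduct_comm] at this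

/-- Points of the face on the line through two extreme points of the face lie between them.
[folklore] -/
theorem exists_param_of_extreme {a b s : Fin 3 → ℝ} (ha : a ∈ face S φ M) (hb : b ∈ face S φ M)
    (haE : a ∈ (convexHull ℝ ((face S φ M : Finset (Fin 3 → ℝ)) : Set (Fin 3 → ℝ))).extremePoints ℝ)
    (hbE : b ∈ (convexHull ℝ ((face S φ M : Finset (Fin 3 → ℝ)) : Set (Fin 3 → ℝ))).extremePoints ℝ)
    (hab : a ≠ b) (hs : s ∈ face S φ M) (h0 : a ⬝ᵥ (b ⨯₃ s) = 0) :
    ∃ θ : ℝ, 0 ≤ θ ∧ θ ≤ 1 ∧ s = a + θ • (b - a) := by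
  have haM : a ⬝ᵥ φ = M := (Finset.mem_filter.1 ha).2
  have hbM : b ⬝ᵥ φ = M := (Finset.mem_filter.1 hb).2
  have hsM : s ⬝ᵥ φ = M := (Finset.mem_filter.1 hs).2
  obtain ⟨θ, hθ⟩ := exists_param_of_triple_eq_zero (φ := φ) h.hM.ne' (by rw [dotProduct_comm]; exact haM)
    (by rw [dotProduct_comm]; exact hbM) (by rw [dotProduct_comm]; exact hsM) hab h0
  obtain ⟨hneg, hbig⟩ := openSegment_of_param hθ
  refine ⟨θ, ?_, ?_, hθ⟩
  · by_contra hlt; rw [not_le] at hlt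
    have := (eq_of_extreme_of_mem_openSegment haE hs hb (hneg hlt)).1
    rw [this] at hθ
    have h2 : θ • (b - a) = 0 := by rw [eq_comm, add_eq_left] at hθ; exact hθ
    rcases smul_eq_zero.1 h2 with h1 | h1
    · linarith
    · exact hab (sub_eq_zero.1 h1).symm
  · by_contra hlt; rw [not_le] at hlt
    have := (eq_of_extreme_of_mem_openSegment hbE ha hs (hbig hlt)).1
    exact hab this

omit h in
/-- The vertex `q_j` is extreme. [folklore] -/
theorem poly_extreme {j : ℕ} (hj1 : 1 ≤ j) (hj2 : j ≤ nverts S φ p₀ M) :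
    poly S φ p₀ M j ∈ (convexHull ℝ ((face S φ M : Finset (Fin 3 → ℝ)) : Set (Fin 3 → ℝ))).extremePoints ℝ :=
  ((mem_verts).1 (poly_mem_verts hj1 hj2)).2.2

/-- **(EDGE), middle sides.** For `1 ≤ j < m` every point `s` of the face satisfies
`[q_j, q_{j+1}, s] ≥ 0`. [cite: KishimotoYoneda2022, §4 Props. 4.4, 4.7 (edges of a face)] -/
theorem triple_side_nonneg {j : ℕ} (hj1 : 1 ≤ j) (hj2 : j + 1 ≤ nverts S φ p₀ M) {s : Fin 3 → ℝ}
    (hs : s ∈ face S φ M) : 0 ≤ poly S φ p₀ M j ⬝ᵥ (poly S φ p₀ M (j + 1) ⨯₃ s) := by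
  set a := poly S φ p₀ M j with ha
  set b := poly S φ p₀ M (j + 1) with hb
  have hjm : j ≤ nverts S φ p₀ M := by omega
  have hj1' : 1 ≤ j + 1 := by omega
  have haV : a ∈ verts S φ p₀ M := poly_mem_verts hj1 hjm
  have hbV : b ∈ verts S φ p₀ M := poly_mem_verts hj1' hj2
  have haF : a ∈ face S φ M := poly_mem_face hj1 hjm
  have hbF : b ∈ face S φ M := poly_mem_face hj1' hj2
  have hab : 0 < p₀ ⬝ᵥ (a ⨯₃ b) := h.triple_poly_pos hj1 (Nat.lt_succ_self j) hj2
  rw [triple_eq_dot_cross]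
  refine dot_nonneg_on_face hab.le ?_ hs
  · intro v hv
    by_contra hneg
    rw [not_le] at hneg
    -- `v` is a vertex strictly beyond the line `ab`
    have hvF : v ∈ face S φ M := ((mem_verts).1 hv).2.1
    have hva : v ≠ a := by
      intro hva; rw [hva, dot_self_cross] at hneg; exact lt_irrefl _ hneg
    have hvb : v ≠ b := by
      intro hvb; rw [hvb, dot_cross_self] at hneg; exact lt_irrefl _ hneg
    have hsa : slope φ p₀ v ≠ slope φ p₀ a := fun he => hva (h.slope_injOn (Finset.mem_coe.2 hv)
      (Finset.mem_coe.2 haV) he)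
    have hsb : slope φ p₀ v ≠ slope φ p₀ b := fun he => hvb (h.slope_injOn (Finset.mem_coe.2 hv)
      (Finset.mem_coe.2 hbV) he)
    have hK : ∀ x ∈ face S φ M, x ∈ convexHull ℝ ((face S φ M : Finset (Fin 3 → ℝ)) : Set (Fin 3 → ℝ)) :=
      fun x hx => subset_convexHull _ _ (Finset.mem_coe.2 hx)
    -- the value `[a, b, v] < 0`
    have hNv : a ⬝ᵥ (b ⨯₃ v) < 0 := by rw [triple_eq_dot_cross]; exact hneg
    rcases lt_or_gt_of_ne hsa with hlt | hgt
    · -- slope v < slope a: `a` lies in the triangle `(p₀, v, b)`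
      have hNc : 0 < p₀ ⬝ᵥ (v ⨯₃ a) := (triple_pos_iff_slope_lt h.hω h.hM h.hpM (verts_plane hv)
        (verts_plane haV) (h.verts_depth_pos hv) (h.verts_depth_pos haV)).2 hlt
      have hNa : 0 < a ⬝ᵥ (v ⨯₃ b) := by
        have : a ⬝ᵥ (v ⨯₃ b) = -(a ⬝ᵥ (b ⨯₃ v)) := by rw [← cross_anticomm, dotProduct_neg]
        rw [this]; linarith
      have hD : a ⬝ᵥ (v ⨯₃ b) + p₀ ⬝ᵥ (a ⨯₃ b) + p₀ ⬝ᵥ (v ⨯₃ a) = p₀ ⬝ᵥ (v ⨯₃ b) :=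
        baryc_sum (φ := φ) h.hM.ne' (by rw [dotProduct_comm]; exact h.hpM)
          (by rw [dotProduct_comm]; exact verts_plane hv) (by rw [dotProduct_comm]; exact verts_plane hbV)
          (by rw [dotProduct_comm]; exact verts_plane haV)
      have hDpos : 0 < p₀ ⬝ᵥ (v ⨯₃ b) := by linarith
      have hcomb := baryc_identity (x := a) hDpos.ne'
      rcases eq_corner_of_mem_extremePoints (poly_extreme hj1 hjm) (hK p₀ h.p₀_mem_face) (hK v hvF)
        (hK b hbF) (div_nonneg hNa.le hDpos.le) (div_nonneg hab.le hDpos.le) (div_nonneg hNc.le hDpos.le)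
        (by field_simp; linarith [hD]) hcomb with h1 | h1 | h1
      · exact ((mem_verts).1 haV).1 h1
      · exact hva h1.symm
      · exact (ne_of_lt (slope_poly_lt hj1 (Nat.lt_succ_self j) hj2)) (congrArg (slope φ p₀) h1)
    · -- slope v > slope a, hence > slope b: `b` lies in the triangle `(p₀, a, v)`
      have hgtb : slope φ p₀ b < slope φ p₀ v := by
        rcases lt_or_gt_of_ne hsb with h1 | h1
        · exact (not_slope_between hj1 hj2 hv hgt h1).elim
        · exact h1
      have hNb : 0 < p₀ ⬝ᵥ (b ⨯₃ v) := (triple_pos_iff_slope_lt h.hω h.hM h.hpM (verts_plane hbV)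
        (verts_plane hv) (h.verts_depth_pos hbV) (h.verts_depth_pos hv)).2 hgtb
      have hNa : 0 < b ⬝ᵥ (a ⨯₃ v) := by
        have : b ⬝ᵥ (a ⨯₃ v) = -(a ⬝ᵥ (b ⨯₃ v)) := by
          simp [cross_apply, dotProduct, Fin.sum_univ_three]; ring
        rw [this]; linarith
      have hD : b ⬝ᵥ (a ⨯₃ v) + p₀ ⬝ᵥ (b ⨯₃ v) + p₀ ⬝ᵥ (a ⨯₃ b) = p₀ ⬝ᵥ (a ⨯₃ v) :=
        baryc_sum (φ := φ) h.hM.ne' (by rw [dotProduct_comm]; exact h.hpM)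
          (by rw [dotProduct_comm]; exact verts_plane haV) (by rw [dotProduct_comm]; exact verts_plane hv)
          (by rw [dotProduct_comm]; exact verts_plane hbV)
      have hDpos : 0 < p₀ ⬝ᵥ (a ⨯₃ v) := by linarith
      have hcomb := baryc_identity (x := b) hDpos.ne'
      rcases eq_corner_of_mem_extremePoints (poly_extreme hj1' hj2) (hK p₀ h.p₀_mem_face) (hK a haF)
        (hK v hvF) (div_nonneg hNa.le hDpos.le) (div_nonneg hNb.le hDpos.le) (div_nonneg hab.le hDpos.le)
        (by field_simp; linarith [hD]) hcomb with h1 | h1 | h1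
      · exact ((mem_verts).1 hbV).1 h1
      · exact (ne_of_lt (slope_poly_lt hj1 (Nat.lt_succ_self j) hj2)) (congrArg (slope φ p₀) h1).symm
      · exact hvb h1.symm

/-- **(EDGE), first side.** Every point `s` of the face satisfies `[p₀, q₁, s] ≥ 0`.
[cite: KishimotoYoneda2022, §4 Props. 4.4, 4.7 (edges of a face)] -/
theorem triple_first_nonneg {s : Fin 3 → ℝ} (hs : s ∈ face S φ M) :
    0 ≤ p₀ ⬝ᵥ (poly S φ p₀ M 1 ⨯₃ s) := by
  have hm : 1 ≤ nverts S φ p₀ M := le_trans (by norm_num) h.two_le_nverts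
  have h1V := poly_mem_verts (S := S) (φ := φ) (p₀ := p₀) (M := M) le_rfl hm
  rw [triple_eq_dot_cross]
  refine dot_nonneg_on_face (by rw [dot_self_cross]) ?_ hs
  intro v hv
  rw [← triple_eq_dot_cross]
  rcases (slope_poly_one_le hv hm).lt_or_eq with hlt | heq
  · exact ((triple_pos_iff_slope_lt h.hω h.hM h.hpM (verts_plane h1V) (verts_plane hv)
      (h.verts_depth_pos h1V) (h.verts_depth_pos hv)).2 hlt).le
  · have : poly S φ p₀ M 1 = v := h.slope_injOn (Finset.mem_coe.2 h1V) (Finset.mem_coe.2 hv) heq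
    rw [this, cross_self, dotProduct_zero]

/-- **(EDGE), last side.** Every point `s` of the face satisfies `[q_m, p₀, s] ≥ 0`.
[cite: KishimotoYoneda2022, §4 Props. 4.4, 4.7 (edges of a face)] -/
theorem triple_last_nonneg {s : Fin 3 → ℝ} (hs : s ∈ face S φ M) :
    0 ≤ poly S φ p₀ M (nverts S φ p₀ M) ⬝ᵥ (p₀ ⨯₃ s) := by
  have hm : 1 ≤ nverts S φ p₀ M := le_trans (by norm_num) h.two_le_nverts
  have hmV := poly_mem_verts (S := S) (φ := φ) (p₀ := p₀) (M := M) hm le_rfl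
  rw [triple_eq_dot_cross]
  refine dot_nonneg_on_face (by rw [dot_cross_self]) ?_ hs
  intro v hv
  have e : v ⬝ᵥ (poly S φ p₀ M (nverts S φ p₀ M) ⨯₃ p₀) = p₀ ⬝ᵥ (v ⨯₃ poly S φ p₀ M (nverts S φ p₀ M)) := by
    simp [cross_apply, dotProduct, Fin.sum_univ_three]; ring
  rw [e]
  rcases (slope_le_poly_last hv hm).lt_or_eq with hlt | heq
  · exact ((triple_pos_iff_slope_lt h.hω h.hM h.hpM (verts_plane hv) (verts_plane hmV)
      (h.verts_depth_pos hv) (h.verts_depth_pos hmV)).2 hlt).le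
  · have : v = poly S φ p₀ M (nverts S φ p₀ M) :=
      h.slope_injOn (Finset.mem_coe.2 hv) (Finset.mem_coe.2 hmV) heq
    rw [this, cross_self, dotProduct_zero]

omit h in
/-- `q_{m+1} = p₀`. [folklore] -/
theorem poly_succ_nverts : poly S φ p₀ M (nverts S φ p₀ M + 1) = p₀ := poly_of_gt (Nat.lt_succ_self _)

/-- Consecutive polygon points are distinct (`0 ≤ j ≤ m`, `q₀ = q_{m+1} = p₀`). [folklore] -/
theorem poly_ne_succ {j : ℕ} (hj : j ≤ nverts S φ p₀ M) : poly S φ p₀ M j ≠ poly S φ p₀ M (j + 1) := by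
  rcases Nat.eq_zero_or_pos j with rfl | hj0
  · rw [poly_zero]
    have := ((mem_verts).1 (poly_mem_verts (S := S) (φ := φ) (p₀ := p₀) (M := M) le_rfl
      (le_trans (by norm_num) h.two_le_nverts))).1
    exact fun e => this e.symm
  · rcases hj.lt_or_eq with hlt | heq
    · intro e
      exact (ne_of_lt (slope_poly_lt hj0 (Nat.lt_succ_self j) hlt)) (congrArg (slope φ p₀) e)
    · rw [heq, poly_succ_nverts]
      exact ((mem_verts).1 (poly_mem_verts (S := S) (φ := φ) (p₀ := p₀) (M := M) (by omega) le_rfl)).1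

/-- Polygon points are in the face and extreme (`0 ≤ j ≤ m + 1`). [folklore] -/
theorem poly_mem_face' {j : ℕ} (hj : j ≤ nverts S φ p₀ M + 1) :
    poly S φ p₀ M j ∈ face S φ M ∧
      poly S φ p₀ M j ∈ (convexHull ℝ ((face S φ M : Finset (Fin 3 → ℝ)) : Set (Fin 3 → ℝ))).extremePoints ℝ := by
  rcases Nat.eq_zero_or_pos j with rfl | hj0
  · rw [poly_zero]; exact ⟨h.p₀_mem_face, h.p₀_extreme⟩
  · rcases (Nat.le_succ_iff.1 hj) with hle | heq
    · exact ⟨poly_mem_face hj0 hle, poly_extreme hj0 hle⟩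
    · rw [heq, poly_succ_nverts]; exact ⟨h.p₀_mem_face, h.p₀_extreme⟩

/-- **(EDGE)** Every side `[q_j, q_{j+1}]`, `0 ≤ j ≤ m` (`q₀ = q_{m+1} = p₀`), of the boundary polygon
is an edge of `S^{conv}`: all points `s` of the face have `[q_j, q_{j+1}, s] ≥ 0`, with equality
only on the segment. [cite: KishimotoYoneda2022, §4 Lemma 4.5, Props. 4.4, 4.7] -/
theorem edge {j : ℕ} (hj : j ≤ nverts S φ p₀ M) {s : Fin 3 → ℝ} (hs : s ∈ face S φ M) :
    0 ≤ poly S φ p₀ M j ⬝ᵥ (poly S φ p₀ M (j + 1) ⨯₃ s) ∧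
      (poly S φ p₀ M j ⬝ᵥ (poly S φ p₀ M (j + 1) ⨯₃ s) = 0 →
        ∃ θ : ℝ, 0 ≤ θ ∧ θ ≤ 1 ∧ s = poly S φ p₀ M j + θ • (poly S φ p₀ M (j + 1) - poly S φ p₀ M j)) := by
  have hnonneg : 0 ≤ poly S φ p₀ M j ⬝ᵥ (poly S φ p₀ M (j + 1) ⨯₃ s) := by
    rcases Nat.eq_zero_or_pos j with rfl | hj0
    · rw [poly_zero]; exact h.triple_first_nonneg hs
    · rcases hj.lt_or_eq with hlt | heq
      · exact h.triple_side_nonneg hj0 hlt hs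
      · rw [heq, poly_succ_nverts]; exact h.triple_last_nonneg hs
  refine ⟨hnonneg, fun h0 => ?_⟩
  obtain ⟨hF, hE⟩ := h.poly_mem_face' (Nat.le_succ_of_le hj)
  obtain ⟨hF', hE'⟩ := h.poly_mem_face' (Nat.succ_le_succ hj)
  exact h.exists_param_of_extreme hF hF' hE hE' (h.poly_ne_succ hj) hs h0

end FaceCfg

end KY

end Literature.Analysis.FluidPDE
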